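import Summits.QuantumFields.YangMills.Theorems.BalabanUVNodesN19LipBracketNestedRadii
import Summits.QuantumFields.BalabanUV.T4Continuum.Support.NE7MarginDisplacementChain
import Literature.NumberTheory.LFunctions.DeBruijnNewmanProofs

/-!
# BalabanUVNodes ∕ N19 — companion of `BalabanUVNodesN19LipBracketNestedRadii` (the hypothesis-only bracket (T) of
# `T4OutputRate.u3_threeBrackets` at the spine carriers): the STRUCTURAL input is of printed KIND (plaquette products are
# locally Lipschitz in the bond variables), NON-VACUITY of the nested-levels producer, and the same bracket (T) at the U3
# carriers in the TRANSPORT-CHAIN reading of the b2b lineage (creation analyticity + the printed layered losses + the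
# one-run displacement input (S1)), its creation margin `hcre` DERIVED by the nested-levels device (cell `pub-ymgap`,
# Track A node N19 = NE7, seat dag-n19-c, strategy s1; count-neutral; split off under the 400-line rule)

HONEST FRAMING.  As in the main file: one fixed finite four-torus, rung (B)+1 — NOT infinite volume, NOT OS on ℝ⁴, NOT a
mass gap, NOT Clay; NE7 NOT PRINTED and NOT proved; N19 NOT discharged; THEOREMS ONLY, 0 `def`, 0 `sorry`, standard
axioms; nothing of Bałaban's objects instantiated.  Filed `--supports` the K3 item `SpineGivenEndpointR11`; NOT a
discharge claim.

WHAT IS PROVED ([folklore] throughout).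
* §5 `norm_mul_sub_mul_le_of_le`, `norm_mul4_sub_mul4_le`, **`plaquetteDev_oneSidedLip`** — in any normed ring the
  four-fold product (a plaquette variable `∂U = U(b₁)U(b₂)U(b₃)U(b₄)` in the bond variables, [Balaban1987RG1] (1.11) p. 262 ∕
  [Balaban1988Convergent] (2.34) p. 261 `|∂𝐔 − 1| < …`) is Lipschitz on bounded sets, whence the plaquette deviation
  `‖∂z − 1‖` on `𝔸⁴` (sup norm) is one-sided `32`-Lipschitz within unit distance of any configuration of bond variables of
  norm `≤ 1`: the hypothesis `hLip` of `N19LipBracketNestedRadii.lipBackground_of_nestedLevels` ∕ `lipBracket_at_u3Carriers`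
  holds for regularity functionals of the printed kind (an INSTANCE — the layered scalings `ξ²(Lⁿξ)^{−2}` of (2.34) and the
  `𝐉`-conditions are the instancer's; NOT an instantiation of Bałaban's spaces).
* §6 **`toy_nestedLevels`** — NON-VACUITY (the bound `‖cos z‖ ≤ e^{|Im z|}` is the tree's
  `Literature.NumberTheory.LFunctions.norm_cos_le_exp_abs_im`, imported, not restated): on the tree's
  `T4TowerRateComposition.toyCarriers` (domains `ℕ`, tree length `0`, backgrounds `ℝ`, gauge `|U − U′|`) with the chart
  `ℝ ↪ ℂ`, the regularity functional `dev z = |Im z|`, the strip `{|Im z| < α}`, the entire functional `E₀e^{−α}cos z` and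
  constant levels `0 ≤ ε < α`, EVERY hypothesis of `lipBackground_of_nestedLevels` holds (window `univ`, `κ = 0`), so the
  producer's hypothesis set is jointly satisfiable and its conclusion inhabited.
* §7 **`lipBracket_at_u3Carriers_of_layeredDisplacement`** — (T) AT NODE U3's CARRIERS IN THE TRANSPORT-CHAIN READING.  The
  main file reads the (2.27)(ii)(iv) shape for the functional AS READ at the cutoff (domain `D s X` containing the creation
  sublevel set — knit v7's reading).  The b2b lineage (`Support/TermwiseAnalyticMarginShrink` → `…Layered` →
  `NE7MarginDisplacementChain`, road P1 leaf T.2) reads it more faithfully: the scale-`j` term is CREATED analytic with the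
  (1.18) bound on its creation space `Dch s X 0` ((2.27)∕(2.28) p. 259) and then TRANSPORTED through the later steps' complex
  background maps `Φ s X k` ((3.6) p. 266), whose displacement is at most the printed layered loss
  `(shrink β k − shrink β (k+1))·ϱ₀` of (2.34)–(2.39) p. 261 (input (S1), ONE-RUN, located-unprinted as an inequality — p. 277
  «the analyticity domains become smaller after each step, but the difference is very small and exponentially decreasing»);
  `NE7MarginDisplacementChain.lipBackground_of_layeredDisplacement` then gives `LipBackground` with constant `8E₀∕ϱ₀` FROM a
  creation margin `hcreate : closedBall (ι U) (ϱ₀ s (scale X)) ⊆ Dch s X 0` — which §1 of the main file PRODUCES from nested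
  levels with `ϱ₀ = (κ₁α_{0,j} − cε_j)∕(2Λ)`, and §2 prices in coupling units.  CONCLUSION: the same triple
  `∃ CU Pg, LipBackground u.EA u.W u.κ CU ∧ PolyLipGrowth CU g Pg 1 ∧ 0 ≤ Pg` at `YMDAG.UVSplit.U3Carriers`, now from
  creation-level shapes + (S1) + the printed design (`0 ≤ β ≤ 1∕2`, printed `β = 1∕4`) + the letters of the main file.
  Both lineages' producers are consumed BY NAME; nothing restated.

CITATION HEADER (LOCATIONS only, as in the main file).  [Balaban1987RG1] CMP **109** (1987) (1.11) p. 262; [Balaban1988Convergent]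
CMP **119** (1988) (2.34) p. 261.
-/

open Metric

namespace Summit.QuantumFields.YangMills.BalabanUVNodes.N19LipBracketNestedRadiiWitness

open Literature.MathematicalPhysics.QuantumFieldTheory.Balaban1983to89
open T4OutputRate (Carriers Functional LipBackground)
open T4TowerRateComposition (PolyLipGrowth toyCarriers)
open T4TowerRateDischarge (polyLipGrowth_of_couplingMargin)
open B14Radii (shrink)
open Summit.QuantumFields.BalabanUV.T4Continuum.NE7MarginDisplacementChain (lipBackground_of_layeredDisplacement)
open Summit.QuantumFields.YangMills.BalabanUVNodes.N19LipBracketNestedRadii (lipBackground_of_nestedLevels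
  creationMargin_of_nestedLevels innerLevel_lt_outerLevel levelGap_ge_mul_coupling)

/-! ## §5 The structural input is of printed KIND: plaquette products are locally Lipschitz in the bond variables -/

section Plaquette

variable {𝔸 : Type*} [NormedRing 𝔸]

/-- Two-fold products: `‖ab − a′b′‖ ≤ M(‖a − a′‖ + ‖b − b′‖)` when `‖a′‖, ‖b‖ ≤ M` (telescoping
`ab − a′b′ = (a − a′)b + a′(b − b′)`). [folklore] -/
theorem norm_mul_sub_mul_le_of_le {a b a' b' : 𝔸} {M : ℝ} (ha' : ‖a'‖ ≤ M) (hb : ‖b‖ ≤ M) :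
    ‖a * b - a' * b'‖ ≤ M * (‖a - a'‖ + ‖b - b'‖) := by
  have e : a * b - a' * b' = (a - a') * b + a' * (b - b') := by
    rw [sub_mul, mul_sub]
    abel
  rw [e]
  calc ‖(a - a') * b + a' * (b - b')‖ ≤ ‖(a - a') * b‖ + ‖a' * (b - b')‖ := norm_add_le _ _
    _ ≤ ‖a - a'‖ * ‖b‖ + ‖a'‖ * ‖b - b'‖ := add_le_add (norm_mul_le _ _) (norm_mul_le _ _)
    _ ≤ ‖a - a'‖ * M + M * ‖b - b'‖ :=
        add_le_add (mul_le_mul_of_nonneg_left hb (norm_nonneg _)) (mul_le_mul_of_nonneg_right ha' (norm_nonneg _))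
    _ = M * (‖a - a'‖ + ‖b - b'‖) := by ring

/-- Four-fold products (a plaquette variable `∂U = U(b₁)U(b₂)U(b₃)U(b₄)` in the bond variables):
`‖abcd − a′b′c′d′‖ ≤ M³(‖a − a′‖ + ‖b − b′‖ + ‖c − c′‖ + ‖d − d′‖)` when `1 ≤ M` bounds the norms of `b, c, d` and of
`a′, b′, c′` (telescoping `(ab)(cd) − (a′b′)(c′d′)`; six of the eight norms suffice). [folklore] -/
theorem norm_mul4_sub_mul4_le {a b c d a' b' c' d' : 𝔸} {M : ℝ} (hM : 1 ≤ M)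
    (hb : ‖b‖ ≤ M) (hc : ‖c‖ ≤ M) (hd : ‖d‖ ≤ M) (ha' : ‖a'‖ ≤ M) (hb' : ‖b'‖ ≤ M) (hc' : ‖c'‖ ≤ M) :
    ‖a * b * c * d - a' * b' * c' * d'‖ ≤
      M ^ 3 * (‖a - a'‖ + ‖b - b'‖ + ‖c - c'‖ + ‖d - d'‖) := by
  have hM0 : 0 ≤ M := zero_le_one.trans hM
  have hM2 : 0 ≤ M ^ 2 := by positivity
  have hMM : M ≤ M ^ 2 := by nlinarith
  -- the two halves are bounded by `M²`
  have hab' : ‖a' * b'‖ ≤ M ^ 2 :=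
    (norm_mul_le _ _).trans (by nlinarith [norm_nonneg a', norm_nonneg b', mul_le_mul ha' hb' (norm_nonneg _) hM0])
  have hcd : ‖c * d‖ ≤ M ^ 2 :=
    (norm_mul_le _ _).trans (by nlinarith [norm_nonneg c, norm_nonneg d, mul_le_mul hc hd (norm_nonneg _) hM0])
  have h1 : ‖a * b - a' * b'‖ ≤ M * (‖a - a'‖ + ‖b - b'‖) := norm_mul_sub_mul_le_of_le ha' hb
  have h2 : ‖c * d - c' * d'‖ ≤ M * (‖c - c'‖ + ‖d - d'‖) := norm_mul_sub_mul_le_of_le hc' hd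
  have e : a * b * c * d - a' * b' * c' * d' = (a * b) * (c * d) - (a' * b') * (c' * d') := by
    simp only [mul_assoc]
  rw [e]
  have h3 : ‖(a * b) * (c * d) - (a' * b') * (c' * d')‖ ≤ M ^ 2 * (‖a * b - a' * b'‖ + ‖c * d - c' * d'‖) :=
    norm_mul_sub_mul_le_of_le hab' hcd
  have hsum : ‖a * b - a' * b'‖ + ‖c * d - c' * d'‖ ≤ M * (‖a - a'‖ + ‖b - b'‖ + ‖c - c'‖ + ‖d - d'‖) := by
    linarith
  calc ‖(a * b) * (c * d) - (a' * b') * (c' * d')‖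
      ≤ M ^ 2 * (‖a * b - a' * b'‖ + ‖c * d - c' * d'‖) := h3
    _ ≤ M ^ 2 * (M * (‖a - a'‖ + ‖b - b'‖ + ‖c - c'‖ + ‖d - d'‖)) := mul_le_mul_of_nonneg_left hsum hM2
    _ = M ^ 3 * (‖a - a'‖ + ‖b - b'‖ + ‖c - c'‖ + ‖d - d'‖) := by ring

/-- **THE PLAQUETTE DEVIATION IS LOCALLY ONE-SIDED LIPSCHITZ IN THE BOND VARIABLES** — the STRUCTURAL input `hLip` of
§§3–4 for a functional of the printed kind (1.11) ∕ (2.34) `|∂𝐔 − 1|`: on `𝔸⁴` with the sup norm, at a configuration `x`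
of bond variables of norm `≤ 1` (unitaries) and within unit distance of it, `‖∂z − 1‖ ≤ ‖∂x − 1‖ + 32·‖z − x‖` (the
constant `32 = 4·2³`: four bonds, all norms `≤ 2`).  An INSTANCE showing the hypothesis is of printed kind — NOT an
instantiation of Bałaban's spaces (the layered scalings `ξ²(Lⁿξ)^{−2}` of (2.34) and the `𝐉`-conditions are the
instancer's). [folklore] -/
theorem plaquetteDev_oneSidedLip {x z : 𝔸 × 𝔸 × 𝔸 × 𝔸}
    (hx : ‖x.1‖ ≤ 1 ∧ ‖x.2.1‖ ≤ 1 ∧ ‖x.2.2.1‖ ≤ 1 ∧ ‖x.2.2.2‖ ≤ 1) (hz : ‖z - x‖ ≤ 1) :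
    ‖z.1 * z.2.1 * z.2.2.1 * z.2.2.2 - 1‖ ≤ ‖x.1 * x.2.1 * x.2.2.1 * x.2.2.2 - 1‖ + 32 * ‖z - x‖ := by
  obtain ⟨hx1, hx2, hx3, hx4⟩ := hx
  -- componentwise distances are dominated by the sup distance
  have d1 : ‖z.1 - x.1‖ ≤ ‖z - x‖ := by simpa using norm_fst_le (z - x)
  have d2 : ‖z.2.1 - x.2.1‖ ≤ ‖z - x‖ := by
    simpa using (norm_fst_le (z - x).2).trans (norm_snd_le (z - x))
  have d3 : ‖z.2.2.1 - x.2.2.1‖ ≤ ‖z - x‖ := by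
    simpa using ((norm_fst_le (z - x).2.2).trans (norm_snd_le (z - x).2)).trans (norm_snd_le (z - x))
  have d4 : ‖z.2.2.2 - x.2.2.2‖ ≤ ‖z - x‖ := by
    simpa using ((norm_snd_le (z - x).2.2).trans (norm_snd_le (z - x).2)).trans (norm_snd_le (z - x))
  -- all eight bond variables have norm ≤ 2
  have bz : ∀ {w y : 𝔸}, ‖y‖ ≤ 1 → ‖w - y‖ ≤ ‖z - x‖ → ‖w‖ ≤ 2 := by
    intro w y hy hwy
    calc ‖w‖ = ‖(w - y) + y‖ := by rw [sub_add_cancel]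
      _ ≤ ‖w - y‖ + ‖y‖ := norm_add_le _ _
      _ ≤ 1 + 1 := add_le_add (hwy.trans hz) hy
      _ = 2 := by norm_num
  have h := norm_mul4_sub_mul4_le (a := z.1) (d' := x.2.2.2) (M := 2) (by norm_num) (bz hx2 d2) (bz hx3 d3)
    (bz hx4 d4) (hx1.trans one_le_two) (hx2.trans one_le_two) (hx3.trans one_le_two)
  have hrev : ‖z.1 * z.2.1 * z.2.2.1 * z.2.2.2 - 1‖ ≤ ‖x.1 * x.2.1 * x.2.2.1 * x.2.2.2 - 1‖
      + ‖z.1 * z.2.1 * z.2.2.1 * z.2.2.2 - x.1 * x.2.1 * x.2.2.1 * x.2.2.2‖ := by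
    have e : z.1 * z.2.1 * z.2.2.1 * z.2.2.2 - 1 = (x.1 * x.2.1 * x.2.2.1 * x.2.2.2 - 1)
        + (z.1 * z.2.1 * z.2.2.1 * z.2.2.2 - x.1 * x.2.1 * x.2.2.1 * x.2.2.2) := by abel
    rw [e]
    exact norm_add_le _ _
  have h32 : (2 : ℝ) ^ 3 * (‖z.1 - x.1‖ + ‖z.2.1 - x.2.1‖ + ‖z.2.2.1 - x.2.2.1‖ + ‖z.2.2.2 - x.2.2.2‖)
      ≤ 32 * ‖z - x‖ := by
    nlinarith [d1, d2, d3, d4]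
  linarith

end Plaquette

/-! ## §6 Non-vacuity: every hypothesis of `lipBackground_of_nestedLevels` met on the tree's toy carriers -/

section Toy

/-- **NON-VACUITY** (toy data, no relation to Bałaban's objects).  On `T4TowerRateComposition.toyCarriers` (domains `ℕ`,
tree length `0`, backgrounds `ℝ`, gauge `|U − U′|`) take the chart `ℝ ↪ ℂ`, the regularity functional `dev z = |Im z|`
(one-sided `1`-Lipschitz from every real point, level `0` there), the strip `{|Im z| < α}` as domain, the entire functional
`E₀e^{−α}cos z` (bounded by `E₀` on the strip, real-valued `E₀e^{−α}cos U` at real backgrounds), constant levels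
`0 ≤ ε < α` and the window `univ` with `κ = 0`: ALL hypotheses of `lipBackground_of_nestedLevels` hold, so its conclusion
`LipBackground` with the derived constant `4E₀∕((α − ε)∕2)` is inhabited. [folklore] -/
theorem toy_nestedLevels {α ε E₀ : ℝ} (hε : 0 ≤ ε) (hεα : ε < α) (hE₀ : 0 ≤ E₀) :
    LipBackground (C := toyCarriers) (fun _ (U : ℝ) _ => E₀ * Real.exp (-α) * Real.cos U) Set.univ 0
      (fun _ _ => 4 * E₀ / ((α - ε) / (2 * 1))) := by
  refine lipBackground_of_nestedLevels (C := toyCarriers) (E := ℂ) (κ := 0) (E₀ := E₀) (Λ := 1)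
    (fun U : ℝ => (U : ℂ)) (fun _ _ => {z : ℂ | |z.im| < α}) (fun _ _ z => |z.im|) (fun _ _ => α) (fun _ _ => ε)
    (fun _ _ z => ((E₀ * Real.exp (-α) : ℝ) : ℂ) * Complex.cos z)
    (fun _ _ _ => subset_rfl) ?_ ?_ ?_ ?_ one_pos ?_ (fun _ _ _ => hεα) ?_
  · -- holomorphy of `E₀e^{−α}cos` on the strip
    intro s _ X
    exact ((Complex.differentiable_cos.const_mul _).differentiableOn)
  · -- the bound `E₀` on the strip (`d ≡ 0`, `κ = 0`)
    intro s _ X z hz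
    have hz' : |z.im| < α := hz
    have hcos : ‖Complex.cos z‖ ≤ Real.exp α :=
      (Literature.NumberTheory.LFunctions.norm_cos_le_exp_abs_im z).trans (Real.exp_le_exp.mpr hz'.le)
    have hexp : 0 < Real.exp (-α) := Real.exp_pos _
    rw [norm_mul, Complex.norm_real, Real.norm_eq_abs, abs_of_nonneg (mul_nonneg hE₀ hexp.le)]
    simp only [mul_zero, neg_zero, Real.exp_zero, mul_one]
    calc E₀ * Real.exp (-α) * ‖Complex.cos z‖ ≤ E₀ * Real.exp (-α) * Real.exp α :=
          mul_le_mul_of_nonneg_left hcos (mul_nonneg hE₀ hexp.le)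
      _ = E₀ := by rw [mul_assoc, ← Real.exp_add]; simp
  · -- real agreement
    intro s _ X U
    push_cast
    ring
  · -- `dev` is one-sided `1`-Lipschitz from real points: `|Im z| = |Im (z − U)| ≤ ‖z − U‖`
    intro s _ X U z _
    have h := Complex.abs_im_le_norm (z - (U : ℂ))
    simp only [Complex.sub_im, Complex.ofReal_im, sub_zero] at h
    simp only [Complex.ofReal_im, abs_zero, one_mul, zero_add]
    exact h
  · -- real backgrounds sit at level `0 ≤ ε`
    intro s _ X U
    simp [hε]
  · -- the chart is dominated by (indeed equal to) the gauge
    intro U U'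
    show ‖(U : ℂ) - (U' : ℂ)‖ ≤ |U - U'|
    rw [← Complex.ofReal_sub, Complex.norm_real, Real.norm_eq_abs]

end Toy

/-! ## §7 (T) at node U3's carriers in the TRANSPORT-CHAIN reading: creation shapes + layered losses + (S1), creation margin derived -/

section Transport

open YMDAG.UVSplit (U3Carriers)

/-- **(T) AT THE U3 CARRIERS FROM THE TRANSPORT CHAIN WITH THE CREATION MARGIN DERIVED.**  For `u : U3Carriers` and run A's
cutoff tables `g`: a chart `ι` of `u.C.BgA` into a complex normed space dominated by `u.C.gauge`; per admissible `s ∈ u.W` and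
domain `X` a CHAIN of spaces `Dch s X k` (`k` = later steps), complex background maps `Φ s X k` analytic on `Dch s X (k+1)`
and displacing its points by at most the printed layered loss `(shrink β k − shrink β (k+1))·ϱ₀ s (scale X)` into the
`d`-THIN previous space ((2.34)–(2.39) design + input (S1)), the (SHRINK) clause for the chain, the scale-`j` term CREATED as
`T s X 0` analytic on `Dch s X 0` with the (1.18) bound and TRANSPORTED `T s X (k+1) = T s X k ∘ Φ s X k`, read after
`N s X` steps as `u.EA s U X`; the creation space CONTAINING the strict sublevel set of a regularity functional `dev s X` at
the outer level `κ₁·α_{0,j}(s)`, the carrier's backgrounds at the inner level `c·ε_j(s)`, the structural modulus `Λ` on the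
half-gap ball; letters `0 ≤ β ≤ 1∕2`, `p₀ ≤ q₀`, `cA₀ < κ₁C₀`, signs, the window's smallness; the tables' membership and
upper running.  THEN `∃ CU Pg, LipBackground u.EA u.W u.κ CU ∧ PolyLipGrowth CU g Pg 1 ∧ 0 ≤ Pg` — with
`CU = 8E₀∕ϱ₀`, `ϱ₀ s j = (κ₁α_{0,j}(s) − cε_j(s))∕(2Λ)`, `Pg = (8E₀∕c₀)(1∕gIR + √β′)`, `c₀ = (κ₁C₀ − cA₀)∕(2Λ)`:
`NE7MarginDisplacementChain.lipBackground_of_layeredDisplacement` (b2b road P1) with its `hcreate` DISCHARGED by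
`creationMargin_of_nestedLevels`, and `T4TowerRateDischarge.polyLipGrowth_of_couplingMargin` at `2E₀` with its `hm`
DISCHARGED by `levelGap_ge_mul_coupling`.  CONDITIONAL on every binder; (S1) stays ONE-RUN located-unprinted; nothing of
Bałaban's instantiated; NOT NE7; N19 NOT discharged. [folklore] -/
theorem lipBracket_at_u3Carriers_of_layeredDisplacement (u : U3Carriers) {E : Type*} [NormedAddCommGroup E]
    [NormedSpace ℂ E] {E₀ Λ κ₁ C₀ c A₀ β β' gIR : ℝ} {p₀ q₀ : ℕ} {g : ℕ → ℕ → ℝ}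
    (ι : u.C.BgA → E) (Dch : (ℕ → ℝ) → u.C.Dom → ℕ → Set E) (Φ : (ℕ → ℝ) → u.C.Dom → ℕ → E → E)
    (N : (ℕ → ℝ) → u.C.Dom → ℕ) (T : (ℕ → ℝ) → u.C.Dom → ℕ → E → ℂ) (dev : (ℕ → ℝ) → u.C.Dom → E → ℝ)
    -- the printed design letter
    (hβ0 : 0 ≤ β) (hβ : β ≤ 1 / 2)
    -- CREATION: (2.27)(ii)(iv) SHAPE on the creation space, which contains the regularity space of radius κ₁α_{0,j}
    (hspace : ∀ s ∈ u.W, ∀ X : u.C.Dom,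
      {z | dev s X z < κ₁ * B14.alphaJ C₀ q₀ (s (u.C.scale X))} ⊆ Dch s X 0)
    (hT0hol : ∀ s ∈ u.W, ∀ X : u.C.Dom, DifferentiableOn ℂ (T s X 0) (Dch s X 0))
    (hT0bd : ∀ s ∈ u.W, ∀ X : u.C.Dom, ∀ z ∈ Dch s X 0, ‖T s X 0 z‖ ≤ E₀ * Real.exp (-(u.κ * u.C.d X)))
    -- TRANSPORT through the later steps: (SHRINK), THIN, the displacement (S1) against the layered loss, analyticity
    (hshrink : ∀ s ∈ u.W, ∀ (X : u.C.Dom) (k : ℕ) (z : E),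
      closedBall z ((shrink β k - shrink β (k + 1)) *
          ((κ₁ * B14.alphaJ C₀ q₀ (s (u.C.scale X))
            - c * (s (u.C.scale X) * p0Profile A₀ p₀ (s (u.C.scale X)))) / (2 * Λ))) ⊆ Dch s X k →
        z ∈ Dch s X (k + 1))
    (hthin : ∀ s ∈ u.W, ∀ (X : u.C.Dom) (k : ℕ), ∀ z ∈ Dch s X (k + 1),
      closedBall z ((shrink β k - shrink β (k + 1)) *
          ((κ₁ * B14.alphaJ C₀ q₀ (s (u.C.scale X))
            - c * (s (u.C.scale X) * p0Profile A₀ p₀ (s (u.C.scale X)))) / (2 * Λ))) ⊆ Dch s X k)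
    (hdisp : ∀ s ∈ u.W, ∀ (X : u.C.Dom) (k : ℕ), ∀ z ∈ Dch s X (k + 1),
      dist (Φ s X k z) z ≤ (shrink β k - shrink β (k + 1)) *
          ((κ₁ * B14.alphaJ C₀ q₀ (s (u.C.scale X))
            - c * (s (u.C.scale X) * p0Profile A₀ p₀ (s (u.C.scale X)))) / (2 * Λ)))
    (hΦhol : ∀ s ∈ u.W, ∀ (X : u.C.Dom) (k : ℕ), DifferentiableOn ℂ (Φ s X k) (Dch s X (k + 1)))
    (hT : ∀ s ∈ u.W, ∀ (X : u.C.Dom) (k : ℕ), T s X (k + 1) = T s X k ∘ Φ s X k)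
    -- the DICTIONARY: after `N s X` later steps the transported term at the embedded background is run A's value
    (hreal : ∀ s ∈ u.W, ∀ (X : u.C.Dom) (U : u.C.BgA), T s X (N s X) (ι U) = (u.EA s U X : ℂ))
    -- STRUCTURE and the (2.18) level of the carrier's backgrounds, as in the main file
    (hLip : ∀ s ∈ u.W, ∀ (X : u.C.Dom) (U : u.C.BgA) (z : E),
      ‖z - ι U‖ ≤ (κ₁ * B14.alphaJ C₀ q₀ (s (u.C.scale X))
          - c * (s (u.C.scale X) * p0Profile A₀ p₀ (s (u.C.scale X)))) / (2 * Λ) →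
        dev s X z ≤ dev s X (ι U) + Λ * ‖z - ι U‖)
    (hΛ : 0 < Λ) (hgauge : ∀ U U' : u.C.BgA, ‖ι U - ι U'‖ ≤ u.C.gauge U U')
    (hlevel : ∀ s ∈ u.W, ∀ (X : u.C.Dom) (U : u.C.BgA),
      dev s X (ι U) ≤ c * (s (u.C.scale X) * p0Profile A₀ p₀ (s (u.C.scale X))))
    -- LETTERS, tables, running
    (hE₀ : 0 ≤ E₀) (hκ₁ : 0 ≤ κ₁) (hC₀ : 0 ≤ C₀) (hC : c * A₀ < κ₁ * C₀) (hpq : p₀ ≤ q₀)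
    (hW : ∀ s ∈ u.W, ∀ j, 0 < s j ∧ s j ^ 2 ≤ Real.exp (-1))
    (hgA : ∀ K, g K ∈ u.W)
    (hup : ∀ K j, j ≤ K → 1 / g K j ^ 2 ≤ 1 / gIR ^ 2 + β' * ((K : ℝ) - j)) (hgIR : 0 < gIR) (hβ' : 0 ≤ β') :
    ∃ (CU : (ℕ → ℝ) → ℕ → ℝ) (Pg : ℝ), LipBackground u.EA u.W u.κ CU ∧ PolyLipGrowth CU g Pg 1 ∧ 0 ≤ Pg := by
  -- the derived creation radius and its letters
  set ϱ₀ : (ℕ → ℝ) → ℕ → ℝ := fun s j =>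
    (κ₁ * B14.alphaJ C₀ q₀ (s j) - c * (s j * p0Profile A₀ p₀ (s j))) / (2 * Λ) with hϱ₀def
  have hgap : ∀ s ∈ u.W, ∀ j, c * (s j * p0Profile A₀ p₀ (s j)) < κ₁ * B14.alphaJ C₀ q₀ (s j) :=
    fun s hs j => innerLevel_lt_outerLevel hκ₁ hC₀ hC hpq (hW s hs j).1 (hW s hs j).2
  have hϱ₀ : ∀ s ∈ u.W, ∀ j, 0 < ϱ₀ s j :=
    fun s hs j => div_pos (sub_pos.mpr (hgap s hs j)) (by positivity)
  have hc₀ : 0 < (κ₁ * C₀ - c * A₀) / (2 * Λ) := div_pos (sub_pos.mpr hC) (by positivity)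
  -- `LipBackground` from the b2b transport chain, `hcreate` DISCHARGED by the nested-levels device
  have hU : LipBackground u.EA u.W u.κ (fun s j => 8 * E₀ / ϱ₀ s j) :=
    lipBackground_of_layeredDisplacement hβ0 hβ ι Dch Φ N ϱ₀ T hϱ₀
      (fun s hs X U => creationMargin_of_nestedLevels (hspace s hs X) (hLip s hs X U) (hlevel s hs X U) hΛ
        (hgap s hs _))
      hshrink hthin hdisp hΦhol hT hT0hol hT0bd hreal hgauge
  -- `PolyLipGrowth` at `2E₀`, `hm` DISCHARGED in coupling units
  have hG : PolyLipGrowth (fun s j => 4 * (2 * E₀) / ϱ₀ s j) g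
      (4 * (2 * E₀) / ((κ₁ * C₀ - c * A₀) / (2 * Λ)) * (1 / gIR + Real.sqrt β')) 1 :=
    polyLipGrowth_of_couplingMargin (ϱ := ϱ₀)
      (fun s hs j => by
        have h := levelGap_ge_mul_coupling (p₀ := p₀) (q₀ := q₀) hκ₁ hC₀ hC.le hpq (hW s hs j).1 (hW s hs j).2
        show (κ₁ * C₀ - c * A₀) / (2 * Λ) * s j ≤ ϱ₀ s j
        rw [hϱ₀def, div_mul_eq_mul_div]
        exact div_le_div_of_nonneg_right h (by positivity))
      hc₀ (by positivity) hgA (fun K j _ => (hW _ (hgA K) j).1) hup hgIR hβ'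
  have e : (fun s j => 4 * (2 * E₀) / ϱ₀ s j) = (fun s j => 8 * E₀ / ϱ₀ s j) := by
    funext s j
    ring
  rw [e] at hG
  exact ⟨_, _, hU, hG, mul_nonneg (div_nonneg (by positivity) hc₀.le) (by positivity)⟩

end Transport

end Summit.QuantumFields.YangMills.BalabanUVNodes.N19LipBracketNestedRadiiWitness
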